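import Literature.NumberTheory.Irrationality.Zudilin2003.ZetaFourRecursion
import HarnessLib

/-!
# Zudilin 2003 (JTNB), §2: the creative-telescoping certificate (23) and **Lemma 2** (24) PROVED

Topic `Literature/NumberTheory/Irrationality/Zudilin2003`, sub-namespace `ZetaFour` (objects of
`ZetaFourRecursion.lean`: `R n t` = the very-well-poised summand (10), `b` (4), `c(n) = 3n³(3n−1)(3n+1)`).
Source: W. Zudilin, *Well-poised hypergeometric service for diophantine problems of zeta values*, J. Théor.
Nombres Bordeaux **15** (2003) 593–626 [Zudilin2003WellPoised], §2, READ ON THE PAGE (held text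
`paper:galaxy-pdf-1593531969313998860`, p0006): "Now, with a help of Zeilberger's algorithm of creative
telescoping ([PWZ], Chapter 6) we get the rational function (*certificate*) `S_n(t) := s_n(t)R_n(t)`, where (23)
`s_n(t) := 1/((2t+n)(t+2n−1)²(t+2n)²) × (−(122n²+115n+29)(t+2(5n−1))t⁷ − (4796n⁴+2336n³−859n²−459n+16)t⁶
− 2(4333n⁵−43n⁴−2645n³−734n²+86n+7)t⁵ − (3965n⁶−13782n⁵−14109n⁴−2207n³+878n²+142n+7)t⁴
+ 2(5906n⁷+17354n⁶+10901n⁵+329n⁴−1340n³−289n²−15n+2)t³ + (22774n⁸+42602n⁷+20740n⁶−2935n⁵−4922n⁴−1162n³+13n²+44n+4)t²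
+ 2n(8249n⁸+13764n⁷+5775n⁶−2178n⁵−2468n⁴−568n³+94n²+64n+8)t + n²(4549n⁸+7531n⁷+2923n⁶−1975n⁵−2056n⁴−424n³+196n²+112n+16))`
satisfying the following property. **Lemma 2.** For each `n = 1, 2, …`, there holds the identity (24)
`(n+1)⁵R_{n+1}(t) − b(n)R_n(t) − 3n³(3n−1)(3n+1)R_{n−1}(t) = S_n(t+1) − S_n(t)`, where the polynomial `b(n)` is
given in (4). *Proof.* Divide both sides of (24) by `R_n(t)` and verify the identity …"

## What is here

DEFINITIONS (printed objects): `sNum` (the polynomial numerator of (23), generic over a commutative ring),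
`s` (the rational function `s_n(t)` of (23)), `S` (`S_n = s_nR_n`); and the three factor blocks `Ablock`,
`Bblock`, `Cblock` of (10) (`R_eq_blocks : R n t = (−1)ⁿ(2t+n)(A_nB_n/C_n²)²` holds by `rfl`).

PROVED: **`lemma2`** — identity (24) at every real `t > 0` and every `n ≥ 1` (the points where §2 uses it:
Lemma 3 sums the derivative of (24) over `t = 1, 2, …`). The source's proof divides by `R_n(t)`, which vanishes at
`t = 1, …, n`; we instead factor the common core `A_{n−1}(t)² B_n(t)²/C_n(t)⁴` out of all five terms
(`Ablock`/`Bblock`/`Cblock`: `A_n = (t−1)⋯(t−n)`, `B_n = (t+n+1)⋯(t+2n)`, `C_n = t(t+1)⋯(t+n)`; the identities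
`R_succ_core_eq`, `R_pred_core_eq`, `R_shift_core_eq`, i.e. the three displayed quotients `R_{n+1}/R_n`, `R_{n−1}/R_n`, `R_n(t+1)/R_n(t)` of the printed
proof in multiplied-out form) and check the remaining identity of fixed rational functions in `(n, t)` by
clearing denominators (`lemma2_polynomial_identity`, by `ring`) — the printed verification. TODO(general form): (24) as an identity in `ℚ(t)`
(all `t` off the poles `0, −1, …, −n−1`, `−n/2`, `−n/2−1`, `1−2n`, `−2n`, `−2n−1`); only `t > 0` is used in §2.

No named facts. HONEST FRAMING (cell zeta5-irr): a step towards the limit (7) of Theorem 1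
(`ZetaFour.theorem1_limit`, still a cited fact); nothing about `ζ(5)`; no rung moves.
-/

noncomputable section

open Finset
open scoped Nat

namespace Literature.NumberTheory.Irrationality.Zudilin2003.ZetaFour

/-! ### The certificate (23) -/

/-- The polynomial numerator of the certificate `s_n(t)` in (23) (a polynomial in `n` and `t` with integer
coefficients, degree `8` in `t`). [cite: Zudilin2003WellPoised, §2 eq. (23)] -/
def sNum {K : Type*} [CommRing K] (n t : K) : K :=
  -(122 * n ^ 2 + 115 * n + 29) * (t + 2 * (5 * n - 1)) * t ^ 7
    - (4796 * n ^ 4 + 2336 * n ^ 3 - 859 * n ^ 2 - 459 * n + 16) * t ^ 6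
    - 2 * (4333 * n ^ 5 - 43 * n ^ 4 - 2645 * n ^ 3 - 734 * n ^ 2 + 86 * n + 7) * t ^ 5
    - (3965 * n ^ 6 - 13782 * n ^ 5 - 14109 * n ^ 4 - 2207 * n ^ 3 + 878 * n ^ 2 + 142 * n + 7) * t ^ 4
    + 2 * (5906 * n ^ 7 + 17354 * n ^ 6 + 10901 * n ^ 5 + 329 * n ^ 4 - 1340 * n ^ 3 - 289 * n ^ 2
        - 15 * n + 2) * t ^ 3
    + (22774 * n ^ 8 + 42602 * n ^ 7 + 20740 * n ^ 6 - 2935 * n ^ 5 - 4922 * n ^ 4 - 1162 * n ^ 3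
        + 13 * n ^ 2 + 44 * n + 4) * t ^ 2
    + 2 * n * (8249 * n ^ 8 + 13764 * n ^ 7 + 5775 * n ^ 6 - 2178 * n ^ 5 - 2468 * n ^ 4 - 568 * n ^ 3
        + 94 * n ^ 2 + 64 * n + 8) * t
    + n ^ 2 * (4549 * n ^ 8 + 7531 * n ^ 7 + 2923 * n ^ 6 - 1975 * n ^ 5 - 2056 * n ^ 4 - 424 * n ^ 3
        + 196 * n ^ 2 + 112 * n + 16)

/-- The certificate `s_n(t) = sNum(n,t)/((2t+n)(t+2n−1)²(t+2n)²)` of (23).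
[cite: Zudilin2003WellPoised, §2 eq. (23)] -/
def s (n : ℕ) (t : ℝ) : ℝ :=
  sNum (n : ℝ) t / ((2 * t + n) * (t + 2 * n - 1) ^ 2 * (t + 2 * n) ^ 2)

/-- `S_n(t) := s_n(t) R_n(t)`. [cite: Zudilin2003WellPoised, §2 (sentence before eq. (23))] -/
def S (n : ℕ) (t : ℝ) : ℝ := s n t * R n t

/-! ### The three blocks of `R_n` and their ratio identities -/

/-- `A_n(t) = (t−1)⋯(t−n)`. [cite: Zudilin2003WellPoised, §2 eq. (10)] -/
def Ablock (n : ℕ) (t : ℝ) : ℝ := ∏ j ∈ range n, (t - (j + 1))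

/-- `B_n(t) = (t+n+1)⋯(t+2n)`. [cite: Zudilin2003WellPoised, §2 eq. (10)] -/
def Bblock (n : ℕ) (t : ℝ) : ℝ := ∏ j ∈ range n, (t + n + (j + 1))

/-- `C_n(t) = t(t+1)⋯(t+n)`. [cite: Zudilin2003WellPoised, §2 eq. (10)] -/
def Cblock (n : ℕ) (t : ℝ) : ℝ := ∏ j ∈ range (n + 1), (t + j)

/-- `R_n = (−1)ⁿ(2t+n)(A_nB_n/C_n²)²`. [cite: Zudilin2003WellPoised, §2 eq. (10)] -/
theorem R_eq_blocks (n : ℕ) (t : ℝ) :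
    R n t = (-1) ^ n * (2 * t + n) * (Ablock n t * Bblock n t / Cblock n t ^ 2) ^ 2 := rfl

/-- Shifting a block of consecutive factors: `(∏_{j<n}(a+j+1))·a = (∏_{j<n}(a+j))·(a+n)`. [folklore] -/
private theorem prod_shift (a : ℝ) (n : ℕ) :
    (∏ j ∈ range n, (a + ((j : ℝ) + 1))) * a = (∏ j ∈ range n, (a + j)) * (a + n) := by
  have h1 := prod_range_succ' (fun j : ℕ => a + (j : ℝ)) n
  have h2 := prod_range_succ (fun j : ℕ => a + (j : ℝ)) n
  simp only [Nat.cast_zero, add_zero, Nat.cast_succ] at h1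
  rw [← h2, h1]

/-- `A_{n+1}(t) = A_n(t)(t−n−1)`. [cite: Zudilin2003WellPoised, §2 (proof of Lemma 2)] -/
theorem Ablock_succ (n : ℕ) (t : ℝ) : Ablock (n + 1) t = Ablock n t * (t - (n + 1)) := by
  unfold Ablock; rw [prod_range_succ]

/-- `C_{n+1}(t) = C_n(t)(t+n+1)`. [cite: Zudilin2003WellPoised, §2 (proof of Lemma 2)] -/
theorem Cblock_succ (n : ℕ) (t : ℝ) : Cblock (n + 1) t = Cblock n t * (t + (n + 1)) := by
  unfold Cblock; rw [prod_range_succ]; push_cast; ring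

/-- `B_n(t+1)(t+n+1) = B_n(t)(t+2n+1)`. [cite: Zudilin2003WellPoised, §2 (proof of Lemma 2)] -/
theorem Bblock_shift (n : ℕ) (t : ℝ) :
    Bblock n (t + 1) * (t + (n + 1)) = Bblock n t * (t + (2 * n + 1)) := by
  unfold Bblock
  have h := prod_shift (t + (n + 1)) n
  have e1 : ∏ j ∈ range n, (t + 1 + (n : ℝ) + ((j : ℝ) + 1)) = ∏ j ∈ range n, (t + (n + 1) + ((j : ℝ) + 1)) :=
    prod_congr rfl fun j _ => by ring
  have e2 : ∏ j ∈ range n, (t + (n : ℝ) + ((j : ℝ) + 1)) = ∏ j ∈ range n, (t + (n + 1) + (j : ℝ)) :=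
    prod_congr rfl fun j _ => by ring
  rw [e1, e2, h]
  ring

/-- `B_{n+1}(t)(t+n+1) = B_n(t)(t+2n+1)(t+2n+2)` (both are `(t+n+1)⋯(t+2n+2)`).
[cite: Zudilin2003WellPoised, §2 (proof of Lemma 2)] -/
theorem Bblock_succ (n : ℕ) (t : ℝ) :
    Bblock (n + 1) t * (t + (n + 1)) = Bblock n t * (t + (2 * n + 1)) * (t + (2 * n + 2)) := by
  have hs := Bblock_shift n t
  have e : Bblock (n + 1) t = Bblock n (t + 1) * (t + (2 * n + 2)) := by
    unfold Bblock
    rw [prod_range_succ]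
    push_cast
    congr 1
    · exact prod_congr rfl fun j _ => by ring
    · ring
  rw [e]
  linear_combination (t + (2 * n + 2)) * hs

/-- `A_n(t+1) = t·A_{n−1}(t)`, written `A_{m+1}(t+1) = t A_m(t)`. [cite: Zudilin2003WellPoised, §2 (proof of Lemma 2)] -/
theorem Ablock_shift (m : ℕ) (t : ℝ) : Ablock (m + 1) (t + 1) = t * Ablock m t := by
  unfold Ablock
  have e1 : ∏ j ∈ range (m + 1), (t + 1 - ((j : ℝ) + 1)) = ∏ j ∈ range (m + 1), (t - (j : ℝ)) :=
    prod_congr rfl fun j _ => by ring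
  have h1 := prod_range_succ' (fun j : ℕ => t - (j : ℝ)) m
  simp only [Nat.cast_zero, sub_zero, Nat.cast_succ] at h1
  rw [e1, h1, mul_comm]

/-- `C_n(t+1)·t = C_n(t)(t+n+1)`. [cite: Zudilin2003WellPoised, §2 (proof of Lemma 2)] -/
theorem Cblock_shift (n : ℕ) (t : ℝ) : Cblock n (t + 1) * t = Cblock n t * (t + (n + 1)) := by
  unfold Cblock
  have h := prod_shift t (n + 1)
  have e1 : ∏ j ∈ range (n + 1), (t + 1 + (j : ℝ)) = ∏ j ∈ range (n + 1), (t + ((j : ℝ) + 1)) :=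
    prod_congr rfl fun j _ => by ring
  rw [e1, h]
  push_cast
  ring

/-- For `t > 0` the block `C_n(t)` is positive. [cite: Zudilin2003WellPoised, §2 eq. (10)] -/
theorem Cblock_pos (n : ℕ) {t : ℝ} (ht : 0 < t) : 0 < Cblock n t := by
  unfold Cblock
  exact prod_pos fun j _ => by positivity

/-! ### `R_{n+1}`, `R_{n−1}`, `R_n(t+1)` against the core `A_{n−1}(t)²B_n(t)²/C_n(t)⁴` (`n = m+1`) -/

/-- `R_{m+1}(t) = (−1)^{m+1}(2t+m+1)(t−m−1)² · A_m²B_{m+1}²/C_{m+1}⁴`. [cite: Zudilin2003WellPoised, §2 (proof of Lemma 2)] -/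
theorem R_core_eq (m : ℕ) (t : ℝ) :
    R (m + 1) t = (Ablock m t ^ 2 * Bblock (m + 1) t ^ 2 / Cblock (m + 1) t ^ 4) *
      ((-1) ^ (m + 1) * (2 * t + (m + 1)) * (t - (m + 1)) ^ 2) := by
  rw [R_eq_blocks, Ablock_succ]
  push_cast
  ring

/-- `R_{m+2}(t) = (−1)^{m}(2t+m+2)(t−m−1)²(t−m−2)²(t+2m+3)²(t+2m+4)²/(t+m+2)⁶ · core` (the printed quotient
`R_{n+1}/R_n = −(2t+n+1)(t−n−1)²(t+2n+1)²(t+2n+2)²/((2t+n)(t+n+1)⁶)`, multiplied out).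
[cite: Zudilin2003WellPoised, §2 (proof of Lemma 2, first displayed quotient)] -/
theorem R_succ_core_eq (m : ℕ) {t : ℝ} (ht : 0 < t) :
    R (m + 2) t = (Ablock m t ^ 2 * Bblock (m + 1) t ^ 2 / Cblock (m + 1) t ^ 4) *
      ((-1) ^ (m + 2) * (2 * t + (m + 2)) * (t - (m + 1)) ^ 2 * (t - (m + 2)) ^ 2 *
        (t + (2 * m + 3)) ^ 2 * (t + (2 * m + 4)) ^ 2 / (t + (m + 2)) ^ 6) := by
  have hB := Bblock_succ (m + 1) t
  have hC := Cblock_succ (m + 1) t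
  have hA : Ablock (m + 2) t = Ablock m t * (t - (m + 1)) * (t - (m + 2)) := by
    rw [show m + 2 = m + 1 + 1 by ring, Ablock_succ, Ablock_succ]; push_cast; ring
  have hden : (t + ((m + 1 : ℕ) + 1)) ≠ 0 := by positivity
  have hB' : Bblock (m + 2) t = Bblock (m + 1) t * (t + (2 * (m + 1 : ℕ) + 1)) * (t + (2 * (m + 1 : ℕ) + 2)) /
      (t + ((m + 1 : ℕ) + 1)) := by
    rw [eq_div_iff hden, ← hB]
  have hCpos := Cblock_pos (m + 1) ht
  rw [R_eq_blocks, hA, hB', show m + 2 = m + 1 + 1 by ring, hC]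
  push_cast
  have h2 : (t + (m + 1 + 1) : ℝ) ≠ 0 := by positivity
  field_simp
  ring

/-- `R_m(t) = (−1)^m(2t+m)(t+m+1)⁶/((t+2m+1)²(t+2m+2)²) · core` (the printed quotient `R_{n−1}/R_n`, multiplied out).
[cite: Zudilin2003WellPoised, §2 (proof of Lemma 2, third displayed quotient)] -/
theorem R_pred_core_eq (m : ℕ) {t : ℝ} (ht : 0 < t) :
    R m t = (Ablock m t ^ 2 * Bblock (m + 1) t ^ 2 / Cblock (m + 1) t ^ 4) *
      ((-1) ^ m * (2 * t + m) * (t + (m + 1)) ^ 6 / ((t + (2 * m + 1)) ^ 2 * (t + (2 * m + 2)) ^ 2)) := by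
  have hB := Bblock_succ m t
  have hC := Cblock_succ m t
  have h1 : (t + (2 * m + 1) : ℝ) ≠ 0 := by positivity
  have h2 : (t + (2 * m + 2) : ℝ) ≠ 0 := by positivity
  have hBm : Bblock m t = Bblock (m + 1) t * (t + (m + 1)) / ((t + (2 * m + 1)) * (t + (2 * m + 2))) := by
    rw [eq_div_iff (mul_ne_zero h1 h2)]
    linear_combination (-1 : ℝ) * hB
  have h3 : (t + (m + 1) : ℝ) ≠ 0 := by positivity
  have hCm : Cblock m t = Cblock (m + 1) t / (t + (m + 1)) := by
    rw [eq_div_iff h3, hC]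
  have hCpos := Cblock_pos (m + 1) ht
  rw [R_eq_blocks, hBm, hCm]
  field_simp

/-- `R_{m+1}(t+1) = (−1)^{m+1}(2t+m+3)t⁶(t+2m+3)²/(t+m+2)⁶ · core` (the printed quotient `R_n(t+1)/R_n(t)`,
multiplied out). [cite: Zudilin2003WellPoised, §2 (proof of Lemma 2, right-hand side quotient)] -/
theorem R_shift_core_eq (m : ℕ) {t : ℝ} (ht : 0 < t) :
    R (m + 1) (t + 1) = (Ablock m t ^ 2 * Bblock (m + 1) t ^ 2 / Cblock (m + 1) t ^ 4) *
      ((-1) ^ (m + 1) * (2 * t + (m + 3)) * t ^ 6 * (t + (2 * m + 3)) ^ 2 / (t + (m + 2)) ^ 6) := by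
  have hA := Ablock_shift m t
  have hB := Bblock_shift (m + 1) t
  have hC := Cblock_shift (m + 1) t
  have h1 : (t + ((m + 1 : ℕ) + 1) : ℝ) ≠ 0 := by positivity
  have hB' : Bblock (m + 1) (t + 1) = Bblock (m + 1) t * (t + (2 * (m + 1 : ℕ) + 1)) / (t + ((m + 1 : ℕ) + 1)) := by
    rw [eq_div_iff h1, hB]
  have hC' : Cblock (m + 1) (t + 1) = Cblock (m + 1) t * (t + ((m + 1 : ℕ) + 1)) / t := by
    rw [eq_div_iff ht.ne', hC]
  have hCpos := Cblock_pos (m + 1) ht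
  rw [R_eq_blocks, hA, hB', hC']
  push_cast
  have h2 : (t + (m + 1 + 1) : ℝ) ≠ 0 := by positivity
  have h3 : t ≠ 0 := ht.ne'
  field_simp
  ring

/-! ### Lemma 2 -/

/-- The identity of fixed rational functions left after factoring out the core: the printed verification
("divide both sides of (24) by `R_n(t)` and verify the identity"), with all denominators cleared — a polynomial
identity in `(n, t)`. [cite: Zudilin2003WellPoised, §2 (proof of Lemma 2)] -/
theorem lemma2_polynomial_identity {K : Type*} [CommRing K] (n t : K) :
    -(n + 1) ^ 5 * (2 * t + n + 1) * (t - n) ^ 2 * (t - n - 1) ^ 2 * (t + 2 * n + 1) ^ 2 *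
          (t + 2 * n + 2) ^ 2 * (t + 2 * n - 1) ^ 2 * (t + 2 * n) ^ 2
      - b n * (2 * t + n) * (t - n) ^ 2 * (t + n + 1) ^ 6 * (t + 2 * n - 1) ^ 2 * (t + 2 * n) ^ 2
      + c n * (2 * t + n - 1) * (t + n) ^ 6 * (t + n + 1) ^ 6
      - sNum n (t + 1) * t ^ 6 * (t + 2 * n - 1) ^ 2
      + sNum n t * (t - n) ^ 2 * (t + n + 1) ^ 6 = 0 := by
  unfold b c sNum
  ring

/-- **Lemma 2** (Zudilin 2003, JTNB §2, eq. (24)) — PROVED at every real `t > 0`: for `n ≥ 1`,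
`(n+1)⁵R_{n+1}(t) − b(n)R_n(t) − 3n³(3n−1)(3n+1)R_{n−1}(t) = S_n(t+1) − S_n(t)` with `S_n = s_nR_n` and the
certificate `s_n` of (23). [cite: Zudilin2003WellPoised, §2 Lemma 2 (eq. (24))] -/
theorem lemma2 (n : ℕ) (hn : 1 ≤ n) (t : ℝ) (ht : 0 < t) :
    ((n : ℝ) + 1) ^ 5 * R (n + 1) t - b (n : ℝ) * R n t - c (n : ℝ) * R (n - 1) t = S n (t + 1) - S n t := by
  obtain ⟨m, rfl⟩ : ∃ m, n = m + 1 := ⟨n - 1, by omega⟩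
  rw [Nat.add_sub_cancel, show m + 1 + 1 = m + 2 from rfl]
  unfold S s
  rw [R_succ_core_eq m ht, R_core_eq m t, R_pred_core_eq m ht, R_shift_core_eq m ht]
  generalize Ablock m t ^ 2 * Bblock (m + 1) t ^ 2 / Cblock (m + 1) t ^ 4 = K
  push_cast
  have h1 : (t + (m + 2) : ℝ) ≠ 0 := by positivity
  have h2 : (t + (2 * m + 1) : ℝ) ≠ 0 := by positivity
  have h3 : (t + (2 * m + 2) : ℝ) ≠ 0 := by positivity
  have h4 : (2 * t + ((m : ℝ) + 1)) ≠ 0 := by positivity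
  have h5 : (2 * t + ((m : ℝ) + 3)) ≠ 0 := by positivity
  have h6 : (t + (2 * (m : ℝ) + 3)) ≠ 0 := by positivity
  -- align the denominators of `s_{m+1}(t)` and `s_{m+1}(t+1)` with `h1`–`h6`
  rw [show (2 * (t + 1) + ((m : ℝ) + 1)) = 2 * t + ((m : ℝ) + 3) by ring,
    show (t + 1 + 2 * ((m : ℝ) + 1) - 1) = t + (2 * (m : ℝ) + 2) by ring,
    show (t + 1 + 2 * ((m : ℝ) + 1)) = t + (2 * (m : ℝ) + 3) by ring,
    show (t + 2 * ((m : ℝ) + 1) - 1) = t + (2 * (m : ℝ) + 1) by ring,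
    show (t + 2 * ((m : ℝ) + 1)) = t + (2 * (m : ℝ) + 2) by ring,
    show ((m : ℝ) + 1 + 1) = (m : ℝ) + 2 by ring]
  field_simp
  unfold sNum b c
  ring

end Literature.NumberTheory.Irrationality.Zudilin2003.ZetaFour

end
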